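import Summits.Ventures.Crystal3D.Statement
import Literature.Geometry.DiscreteGeometry.HarborthConstruction
import HarnessLib

/-!
# Harborth's lower bound in the venture's vocabulary: `⌊3N − √(12N − 3)⌋ ≤ C₂(N)` for every `N`

Venture `Crystal3D` (cell `pub-crystal3d`, seat p3; one-line bridge asked by the lead 12:57Z). Seat lit-1 proved Harborth's
construction (Harborth 1974 (6), Heitmann–Radin 1980 §3 (2)) for ALL `N` in the Literature
(`exists_contactPairCount_eq_harborthNumber`: a packing of `N` unit discs — hexagonal spiral patch of the triangular
lattice — with exactly `harborthNumber N = ⌊3N − √(12N − 3)⌋` contacts). This file reads it through the venture's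
definitions (`IsUnitPacking` = pairwise distance `≥ 1`; `numContacts = contactPairCount` by `rfl`; `maxContacts 2 N` the
maximum): `harborthNumber_le_maxContacts_two`, and records that the venture Prop `HarborthFormula N` / `HarborthTheorem`
now reduces to Harborth's UPPER bound (5) alone (`harborthFormula_of_upperBound`, `harborthTheorem_of_upperBound`).
HONEST FRAMING: the upper bound `C₂(N) ≤ ⌊3N − √(12N − 3)⌋` for free discs is NOT proved here (it stays the Literature named
fact `Harborth1974_contactNumber`; the tree has it kernel-checked only for `N ≤ 7`, `SmallDiscValues.lean`).
-/

noncomputable section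

namespace Summit.Ventures.Crystal3D

open Literature.Geometry.DiscreteGeometry (harborthNumber contactPairCount exists_contactPairCount_eq_harborthNumber)

/-- **Harborth's lower bound (6), all `N`:** `⌊3N − √(12N − 3)⌋ ≤ C₂(N)`, the maximal contact number of `N` unit discs in
the plane (lit-1's hexagonal-spiral construction, read in the venture's vocabulary). [cite: Harborth1974, (6)] -/
theorem harborthNumber_le_maxContacts_two (N : ℕ) : harborthNumber N ≤ (maxContacts 2 N : ℤ) := by
  obtain ⟨x, hx, hN⟩ := exists_contactPairCount_eq_harborthNumber N
  rw [← hN, ← numContacts_eq_contactPairCount]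
  exact_mod_cast numContacts_le_maxContacts (d := 2) hx

/-- Hence `HarborthFormula N` (`C₂(N) = ⌊3N − √(12N − 3)⌋`) follows from the UPPER bound alone: every packing of `N` unit
discs has at most `harborthNumber N` contacts. [folklore] -/
theorem harborthFormula_of_upperBound {N : ℕ}
    (h : ∀ x : Fin N → EuclideanSpace ℝ (Fin 2), IsUnitPacking x → (numContacts x : ℤ) ≤ harborthNumber N) :
    HarborthFormula N := by
  refine le_antisymm ?_ (harborthNumber_le_maxContacts_two N)
  obtain ⟨x, hx, hxe⟩ := exists_numContacts_eq_maxContacts (d := 2) (by norm_num) N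
  rw [← hxe]
  exact h x hx

/-- And `HarborthTheorem` (the formula for every `N`) from the upper bound for every `N`. [folklore] -/
theorem harborthTheorem_of_upperBound
    (h : ∀ (N : ℕ) (x : Fin N → EuclideanSpace ℝ (Fin 2)), IsUnitPacking x → (numContacts x : ℤ) ≤ harborthNumber N) :
    HarborthTheorem :=
  fun N => harborthFormula_of_upperBound (h N)

end Summit.Ventures.Crystal3D

end
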